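import Mathlib
import HarnessLib
import Summits.Ventures.LatticeQCDFlow.Scoring.SelfNormalisedReweightingCLT

/-!
# The STUDENTISED central limit theorem for the printed self-normalised estimate:
# `(Sₙ − E_p O)/√V̂ₙ ⇒ N(0, 1)` — the printed error bar `√V̂ₙ` has asymptotically exact coverage

HONEST FRAMING: exact (Metropolis-corrected) sampling algorithms for lattice gauge theory;
figures of merit are autocorrelation/cost numbers at stated couplings and volumes; no
continuum-physics claim.

Venture `LatticeQCDFlow` (cell pub-lqcd), topic `Scoring`; FANOUT row 4 (`s0-u1-b`, rung S0-B:
'A vs B within `1σ_comb`').  Sequel of `Scoring/SelfNormalisedReweightingCLT`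
(`√n(Sₙ − a) ⇒ N(0, σ²)`, `σ² = ∫ (p²/q)(O − a)² dμ`, `a = E_p O`) and
`Scoring/SelfNormalisedErrorBarConsistency` (`n·V̂ₙ → σ²` almost surely for the printed squared
standard error `V̂ₙ = Σ w̃ᵢ²(Oᵢ − Sₙ)²/(Σ w̃ᵢ)²`), both imported.  One more Slutsky step (Mathlib's
`TendstoInDistribution.continuous_comp_prodMk_of_tendstoInMeasure_const` with the continuous
`g(x, v) = x/√(max(v, σ²/2))`, then `tendstoInDistribution_of_tendstoInMeasure_sub` for the
eventually-vanishing difference) gives, when `σ² > 0`, the studentised statement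
`(Sₙ − a)/√V̂ₙ ⇒ N(0, 1)`: the interval `Sₙ ± z·√V̂ₙ` printed by a flow code has asymptotic coverage
`P(|N(0,1)| ≤ z)` — e.g. `68.3 %` at `z = 1` — for every signed, unbounded observable with the
second-moment inputs of the error-bar file, whatever the normalisation `c ≠ 0` of the weights.
This is an ASYMPTOTIC statement (no finite-`n` guarantee: those are row 4's median-of-blocks
certificates); printed counterparts NAMED ONLY (Geweke 1989; Owen 2013 §9.2); nothing cited as a
fact; NEW WORK of the cell; no definition is introduced.

## Content (`a = ∫ p·O dμ`; `σ² = ∫ (p²/q)(O − a)² dμ > 0`; `Y₁` any standard normal variable)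

* `hasLaw_sqrt_mul_gaussian` (`√σ²·Y₁ ∼ N(0, σ²)`), `studentise_eq_of_pos` (the algebra
  `(Sₙ − a)/√V̂ₙ = √n(Sₙ − a)/√(max(nV̂ₙ, σ²/2))` once `nV̂ₙ > σ²/2`, `n ≥ 1`);
* **`selfNormReweighting_studentised_clt`** —
  `TendstoInDistribution (n ↦ (Sₙ − ∫ p·O dμ)/√V̂ₙ) atTop Y₁`.

NOT CLAIMED: `σ² = 0` (then `V̂ₙ → 0` and the studentised ratio is degenerate); a Berry–Esseen
rate; the chain-side (`τ_int`-inflated) error bar; any number of ours re-scored.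
-/

noncomputable section

namespace Summit.Ventures.LatticeQCDFlow.Scoring.CardConsistency

open MeasureTheory ProbabilityTheory Finset Real Filter
open scoped Topology Function

section Studentised

variable {Ω : Type*} [MeasurableSpace Ω] {P : Measure Ω} [IsProbabilityMeasure P]
variable {Ω' : Type*} [MeasurableSpace Ω'] {P' : Measure Ω'} [IsProbabilityMeasure P']
variable {X : Type*} [MeasurableSpace X] {μ : Measure X} {p q O : X → ℝ} {y : ℕ → Ω → X}
variable {Y₁ : Ω' → ℝ}

omit [IsProbabilityMeasure P'] in
/-- `√s·Y₁ ∼ N(0, s)` for a standard normal `Y₁` and `s ≥ 0`. [folklore] -/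
theorem hasLaw_sqrt_mul_gaussian (hY1 : HasLaw Y₁ (gaussianReal 0 1) P') {s : ℝ} (hs : 0 ≤ s) :
    HasLaw (fun ω' => Real.sqrt s * Y₁ ω') (gaussianReal 0 s.toNNReal) P' := by
  have h := gaussianReal_const_mul hY1 (Real.sqrt s)
  have e : NNReal.mk (Real.sqrt s ^ 2) (sq_nonneg _) * 1 = s.toNNReal :=
    NNReal.eq (by simp [Real.sq_sqrt hs, Real.coe_toNNReal _ hs])
  rw [mul_zero, e] at h
  exact h

omit [MeasurableSpace X] in
/-- **The algebra of studentisation**: for `n ≥ 1` and `σ²/2 < n·V̂`,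
`(S − a)/√V̂ = (√n·(S − a))/√(max(n·V̂, σ²/2))`. [ours] -/
theorem studentise_eq_of_pos {S a V s : ℝ} {n : ℕ} (hn1 : 1 ≤ n) (hV : s / 2 < (n : ℝ) * V) :
    (S - a) / Real.sqrt V = Real.sqrt n * (S - a) / Real.sqrt (max ((n : ℝ) * V) (s / 2)) := by
  have hn0 : (0 : ℝ) < n := by exact_mod_cast hn1
  have hsq : Real.sqrt n ≠ 0 := (Real.sqrt_pos.2 hn0).ne'
  rw [max_eq_left hV.le, Real.sqrt_mul hn0.le, mul_div_mul_left _ _ hsq]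

/-- **THE STUDENTISED CLT FOR THE PRINTED SELF-NORMALISED ESTIMATE.**  One independent proposal
stream `yᵢ` (laws `μ.withDensity q`); `p` measurable, integrable, `∫ p dμ = 1`; `q > 0`
measurable; `O` measurable with `p·O`, `p²/q`, `(p²/q)O`, `(p²/q)O² ∈ L¹(μ)` and a POSITIVE
sandwich variance `σ² = ∫ (p²/q)(O − ∫ p·O dμ)² dμ`; weights printed with ANY normalisation
`w̃ = c·p/q`, `c ≠ 0`; `Y₁` any standard normal variable.  With
`Sₙ = Σ_{i<n} w̃ᵢO(yᵢ)/Σ_{i<n} w̃ᵢ` and `V̂ₙ = Σ_{i<n} w̃ᵢ²(O(yᵢ) − Sₙ)²/(Σ_{i<n} w̃ᵢ)²` the printed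
estimate and squared standard error: `(Sₙ − ∫ p·O dμ)/√V̂ₙ ⇒ Y₁` in distribution. [ours] -/
theorem selfNormReweighting_studentised_clt (hym : ∀ j, Measurable (y j)) (hind : iIndepFun y P)
    (hlaw : ∀ j, Measure.map (y j) P = μ.withDensity fun z => ENNReal.ofReal (q z))
    (hpm : Measurable p) (hpi : Integrable p μ) (hp1 : ∫ z, p z ∂μ = 1) (hq0 : ∀ z, 0 < q z)
    (hqm : Measurable q) (hOm : Measurable O) (hpO : Integrable (fun z => p z * O z) μ)
    (hM2i : Integrable (fun z => p z ^ 2 / q z) μ)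
    (hT1i : Integrable (fun z => p z ^ 2 / q z * O z) μ)
    (hT2i : Integrable (fun z => p z ^ 2 / q z * O z ^ 2) μ)
    (hσ : 0 < ∫ z, p z ^ 2 / q z * (O z - ∫ x, p x * O x ∂μ) ^ 2 ∂μ) {wt : X → ℝ} {c : ℝ}
    (hc : c ≠ 0) (hwt : ∀ z, wt z = c * (p z / q z)) (hY1 : HasLaw Y₁ (gaussianReal 0 1) P') :
    TendstoInDistribution (fun (n : ℕ) ω =>
        ((∑ i ∈ range n, wt (y i ω) * O (y i ω)) / (∑ i ∈ range n, wt (y i ω))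
            - ∫ x, p x * O x ∂μ)
          / Real.sqrt ((∑ i ∈ range n, wt (y i ω) ^ 2 * (O (y i ω)
              - (∑ j ∈ range n, wt (y j ω) * O (y j ω)) / (∑ j ∈ range n, wt (y j ω))) ^ 2)
            / (∑ i ∈ range n, wt (y i ω)) ^ 2))
      atTop Y₁ (fun _ => P) P' := by
  obtain ⟨a, ha⟩ : ∃ a : ℝ, a = ∫ x, p x * O x ∂μ := ⟨_, rfl⟩
  obtain ⟨s, hs⟩ : ∃ s : ℝ, s = ∫ z, p z ^ 2 / q z * (O z - a) ^ 2 ∂μ := ⟨_, rfl⟩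
  rw [← ha] at hσ ⊢
  rw [← hs] at hσ
  have hwtm : Measurable wt := by
    have h : wt = fun z => c * (p z / q z) := funext hwt
    rw [h]
    exact (hpm.div hqm).const_mul c
  -- the CLT with limit `√s·Y₁ ∼ N(0, s)`
  have hYg : HasLaw (fun ω' => Real.sqrt s * Y₁ ω')
      (gaussianReal 0 (∫ z, p z ^ 2 / q z * (O z - ∫ x, p x * O x ∂μ) ^ 2 ∂μ).toNNReal) P' := by
    rw [← ha, ← hs]
    exact hasLaw_sqrt_mul_gaussian hY1 hσ.le
  have hclt := selfNormReweighting_clt hym hind hlaw hpm hpi hp1 hq0 hqm hOm hpO hM2i hT1i hT2i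
    hc hwt hYg
  rw [← ha] at hclt
  -- `n·V̂ₙ → s` in probability
  have hVm : ∀ n : ℕ, Measurable fun ω => (n : ℝ) * ((∑ i ∈ range n, wt (y i ω) ^ 2 * (O (y i ω)
      - (∑ j ∈ range n, wt (y j ω) * O (y j ω)) / (∑ j ∈ range n, wt (y j ω))) ^ 2)
        / (∑ i ∈ range n, wt (y i ω)) ^ 2) := by
    intro n
    have hS : Measurable fun ω =>
        (∑ j ∈ range n, wt (y j ω) * O (y j ω)) / (∑ j ∈ range n, wt (y j ω)) :=
      (Finset.measurable_sum _ fun j _ => (hwtm.comp (hym j)).mul (hOm.comp (hym j))).div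
        (Finset.measurable_sum _ fun j _ => hwtm.comp (hym j))
    exact ((Finset.measurable_sum _ fun i _ => ((hwtm.comp (hym i)).pow_const 2).mul
      (((hOm.comp (hym i)).sub hS).pow_const 2)).div
      ((Finset.measurable_sum _ fun i _ => hwtm.comp (hym i)).pow_const 2)).const_mul _
  have hVae := selfNormErrorBar_tendsto_ae hym hind hlaw hpm hpi hp1 hq0 hqm hOm hpO hM2i hT1i
    hT2i hc hwt
  rw [← ha, ← hs] at hVae
  have hV : TendstoInMeasure P (fun (n : ℕ) ω => (n : ℝ) * ((∑ i ∈ range n, wt (y i ω) ^ 2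
      * (O (y i ω) - (∑ j ∈ range n, wt (y j ω) * O (y j ω)) / (∑ j ∈ range n, wt (y j ω))) ^ 2)
        / (∑ i ∈ range n, wt (y i ω)) ^ 2)) atTop (fun _ => s) :=
    tendstoInMeasure_of_tendsto_ae (fun n => (hVm n).aestronglyMeasurable) hVae
  -- Slutsky with `g(x, v) = x / √(max(v, s/2))`
  have hden : ∀ v : ℝ, Real.sqrt (max v (s / 2)) ≠ 0 := fun v =>
    (Real.sqrt_pos.2 (lt_max_of_lt_right (half_pos hσ))).ne'
  have hgc : Continuous fun z : ℝ × ℝ => z.1 / Real.sqrt (max z.2 (s / 2)) :=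
    continuous_fst.div ((continuous_snd.max continuous_const).sqrt) fun z => hden z.2
  have hsl := hclt.continuous_comp_prodMk_of_tendstoInMeasure_const hgc hV
    (fun n => (hVm n).aemeasurable)
  have elim : (fun ω' => Real.sqrt s * Y₁ ω' / Real.sqrt (max s (s / 2))) = Y₁ := by
    funext ω'
    rw [max_eq_left (by linarith), mul_div_assoc, mul_div_left_comm, div_self
      (Real.sqrt_pos.2 hσ).ne', mul_one]
  rw [elim] at hsl
  -- the printed studentised statistic agrees with the Slutsky statistic eventually, almost surely
  have hXm : ∀ n : ℕ, Measurable fun ω => Real.sqrt n *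
      ((∑ i ∈ range n, wt (y i ω) * O (y i ω)) / (∑ i ∈ range n, wt (y i ω)) - a) := fun n =>
    (((Finset.measurable_sum _ fun i _ => (hwtm.comp (hym i)).mul (hOm.comp (hym i))).div
      (Finset.measurable_sum _ fun i _ => hwtm.comp (hym i))).sub_const a).const_mul _
  have hTm : ∀ n : ℕ, Measurable fun ω =>
      ((∑ i ∈ range n, wt (y i ω) * O (y i ω)) / (∑ i ∈ range n, wt (y i ω)) - a)
        / Real.sqrt ((∑ i ∈ range n, wt (y i ω) ^ 2 * (O (y i ω)
            - (∑ j ∈ range n, wt (y j ω) * O (y j ω)) / (∑ j ∈ range n, wt (y j ω))) ^ 2)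
          / (∑ i ∈ range n, wt (y i ω)) ^ 2) := by
    intro n
    have hS : Measurable fun ω =>
        (∑ j ∈ range n, wt (y j ω) * O (y j ω)) / (∑ j ∈ range n, wt (y j ω)) :=
      (Finset.measurable_sum _ fun j _ => (hwtm.comp (hym j)).mul (hOm.comp (hym j))).div
        (Finset.measurable_sum _ fun j _ => hwtm.comp (hym j))
    exact (hS.sub_const a).div ((Finset.measurable_sum _ fun i _ =>
      ((hwtm.comp (hym i)).pow_const 2).mul (((hOm.comp (hym i)).sub hS).pow_const 2)).div
      ((Finset.measurable_sum _ fun i _ => hwtm.comp (hym i)).pow_const 2)).sqrt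
  refine tendstoInDistribution_of_tendstoInMeasure_sub (μ'' := P) (μ' := P') _ Y₁ hsl ?_
    (fun n => (hTm n).aemeasurable)
  refine tendstoInMeasure_of_tendsto_ae
    (fun n => ((hTm n).sub ((hXm n).div ((hVm n).max measurable_const).sqrt)).aestronglyMeasurable)
    ?_
  filter_upwards [hVae] with ω hVω
  have hpos : ∀ᶠ n : ℕ in atTop, s / 2 < (n : ℝ) * ((∑ i ∈ range n, wt (y i ω) ^ 2 * (O (y i ω)
      - (∑ j ∈ range n, wt (y j ω) * O (y j ω)) / (∑ j ∈ range n, wt (y j ω))) ^ 2)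
        / (∑ i ∈ range n, wt (y i ω)) ^ 2) :=
    hVω.eventually_const_lt (by linarith)
  refine (tendsto_const_nhds (x := (0 : ℝ))).congr' ?_
  filter_upwards [hpos, eventually_ge_atTop 1] with n hn hn1
  rw [Pi.sub_apply, Pi.sub_apply, studentise_eq_of_pos hn1 hn]
  ring

end Studentised

end Summit.Ventures.LatticeQCDFlow.Scoring.CardConsistency

end
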